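import Summits.BirchSwinnertonDyer.BirchSwinnertonDyer.Theorems.GenusKolyvaginAtTwoMinimalTwinBSDTwoKrizLiAnchorWallSS
import Summits.BirchSwinnertonDyer.BirchSwinnertonDyer.Theorems.GenusKolyvaginAtTwoMinimalTwinBSDTwoKrizLiAnchor11a1
import Summits.BirchSwinnertonDyer.BirchSwinnertonDyer.Theorems.GenusKolyvaginAtTwoMinimalTwinBSDTwoKrizLiAnchor37b1RootNumber
import Summits.BirchSwinnertonDyer.BirchSwinnertonDyer.Theorems.GenusKolyvaginAtTwoMinimalTwinBSDTwoKrizLiAnchor67a1RootNumber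
import Summits.BirchSwinnertonDyer.BirchSwinnertonDyer.Theorems.GenusKolyvaginAtTwoMinimalTwinBSDTwoKrizLiAnchor37a1
import Summits.BirchSwinnertonDyer.BirchSwinnertonDyer.Theorems.GenusKolyvaginAtTwoMinimalTwinBSDTwoKrizLiAnchor43a1
import HarnessLib

/-!
# Route `GenusKolyvaginAtTwo`, crux U₂ `MinimalTwinBSDTwo` (stmt-BirchSwinnertonDyer-22985), LINE 23 «twin_swap» — BY-PRODUCT FOR THE WALL: the PRINT-ALONE Kriz–Li packets
# (`11a1`, `37b1`, `67a1` rank zero; `37a1`, `43a1` rank one) deliver PRINT-DECIDED INSTANCES of the SUPERSINGULAR rank-zero wall row (item 19097 `SupersingularRankZeroAtTwo` /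
# this route's `WallSupersingularRankZeroAtTwo`): their RANK-ZERO halves are non-CM, analytic rank `0`, GOOD SUPERSINGULAR at `2`, with `BSD₂` — beyond Creutz–Miller's range

Seat `bsd-line-gk2-p2` g35 (PROVER 2/3, cell `bsd-f1-sign2`; LINE 23 holder), `--supports stmt-BirchSwinnertonDyer-22985` (helper; closes nothing; bears on 19097).
THEOREMS ONLY (0 `def`, 0 `sorry`); standard axioms.  HONEST FRAMING (D-0014/D-0036): the roads `…KrizLiAnchor11a1/37b1/67a1/37a1/43a1.lean` (this lineage) settle
`BSD(·, 2)` on BOTH halves of their packets from PRINT (Kriz–Li Thm 5.1 (2)/4.3 + the printed (★) row + Creutz–Miller at `N` and `49N`, both `< 5000`); the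
rank-ZERO half consists of twists by `d ≡ 1 (mod 4)` (resp. `−7d ≡ 1 (mod 4)`) of an anchor that is GOOD SUPERSINGULAR at `2` (`a₁ = 0` on the minimal model:
Kriz–Li's standing «formal group at 2 not 𝔾_m», i.e. (★) forces `a₂` even), so by the transport `goodSS_two_of_smul_quadraticTwist_of_emod_four_eq_one` (g34,
`…KrizLiAnchorWallSS.lean`) every such member is good supersingular at `2`: `wallSSInstances_<T>` returns `r_an = 0 ∧ ¬CM ∧ GoodSS · 2 ∧ BSDp · 2` — the
HYPOTHESES AND THE CONCLUSION of the supersingular wall row, decided by print (+ modularity for the rank sorting at `11a1`/`37b1`/`67a1`/`37a1`, GZK at `43a1`).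
Smallest such instances beyond Creutz–Miller: `11a1^{(−23)}` (`N = 5819`), `11a1^{(37)}` (`15059`), `43a1^{(77)}` (`254947`), `37a1^{(−371)}` (`5092717`);
each family is infinite (Kriz–Li Thm 1.4).  The wall row itself (a `∀`-statement) is NOT proved; **BSD is NOT proved by any of this; U₂ is NOT proved; no item is closed.**

References: [KrizLi2019] Thm 5.1 (2), Thm 4.3, Thm 1.4, §6 Ex. 6.1, 6.4, 6.5, Tables 1–2; [CreutzMiller2012] Thm 1.1; [SilvermanAEC2009] V.4, X.2 Prop. 2.4; [Pal2012] Prop. 2.5.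
-/

set_option autoImplicit false
-- the Theorems namespace of this sub repeats the summit name by design (D-0017 nested layout)
set_option linter.dupNamespace false

noncomputable section

open scoped Classical

open WeierstrassCurve NumberField Literature.NumberTheory.EllipticCurves
  Literature.NumberTheory.EllipticCurves.ModularForms
  Literature.NumberTheory.EllipticCurves.Rank1Residual
  Literature.NumberTheory.EllipticCurves.Rank1Residual.Typed
  Literature.NumberTheory.EllipticCurves.X1Eleven
  Summit.BirchSwinnertonDyer.Rank1Residual
  Summit.BirchSwinnertonDyer.Rank1Residual.P2
  Summit.BirchSwinnertonDyer.BirchSwinnertonDyer.Theorems.AddPotGoodPrint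
  Summit.BirchSwinnertonDyer.BirchSwinnertonDyer.Theorems.OrdinaryTwistAtTwo
  Summit.BirchSwinnertonDyer.BirchSwinnertonDyer.Theorems.GenusExact.TwinSwap.KrizLiAnchorWall

namespace Summit.BirchSwinnertonDyer.BirchSwinnertonDyer.Theorems.GenusExact.TwinSwap.KrizLiAnchorsPrintWallSS

/-! ### `11a1` (rank-zero anchor): the rank-zero members `11a1^{(d)}` are good supersingular at `2` -/

/-- **`11a1` is good SUPERSINGULAR at `2`** (`a₁ = 0` on the minimal model; Kriz–Li's (★) needs `a₂` even). [cite: SilvermanAEC2009, V.4] [cite: KrizLi2019, §6 Example 6.2/6.5] -/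
theorem goodSS_two_11A1 :
    haveI := Literature.NumberTheory.EllipticCurves.BurungaleSkinner2023.isGloballyMinimal_curve11A1; haveI : Fact (Nat.Prime 2) := ⟨Nat.prime_two⟩
    GoodSS curve11A1 2 := by
  haveI := X1Eleven.instIsEllipticCurve11A1; haveI := Literature.NumberTheory.EllipticCurves.BurungaleSkinner2023.isGloballyMinimal_curve11A1
  exact goodSS_two_of_even_a₁ _ KrizLiAnchor11a1.hasGoodReductionAtPrime_two_11A1 (by rw [KrizLiAnchor11a1.intModel_11A1]; exact ⟨0, rfl⟩)

/-- ★ **PRINT-DECIDED INSTANCES OF THE SUPERSINGULAR RANK-ZERO WALL ROW** (item 19097 / the route's `WallSupersingularRankZeroAtTwo`): at every global minimal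
`W₁ ≅ 11a1^{(d)}` (`d ∈ 𝒩(11a1, K)`, `d_K = -7`, `χ_d(−N) = 1`): `r_an(W₁) = 0 ∧ ¬CM(W₁) ∧ GoodSS W₁ 2 ∧ BSD(W₁, 2)` — the wall row's hypotheses AND its conclusion,
from PRINT + MODULARITY alone (no wall item used).  BSD is not proved by any of this; the wall row is NOT proved (these are instances).
[cite: KrizLi2019, Thm. 5.1 (2), Thm. 4.3, §6 Table 2 / Example 6.4–6.5] [cite: CreutzMiller2012, Thm. 1.1] -/
theorem wallSSInstances_11A1 (hKL : KrizLi2019.thm112_bsdTwo_twist) (h33 : KrizLi2019.thm33_rank_twist)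
    (htab : KrizLi2019.table2_row11a1) (hS31 : bsdTriple_of_analyticRank_le_one_of_conductor_lt) (hmod : exists_isNewformOf)
    (K : Type) [Field K] [NumberField K] (hK : IsImaginaryQuadratic K) (hdK : NumberField.discr K = -7)
    {d : ℤ} (hd : haveI := Literature.NumberTheory.EllipticCurves.BurungaleSkinner2023.isGloballyMinimal_curve11A1; KrizLi2019.InN curve11A1 K d)
    (hsign : haveI := X1Eleven.instIsEllipticCurve11A1; Int.sign d * jacobiSym (curve11A1.conductorNorm ℤ) d.natAbs = 1)
    (W₁ : WeierstrassCurve ℚ) [W₁.IsElliptic] [W₁.IsGloballyMinimal]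
    (hW₁ : ∃ C : VariableChange ℚ, C • curve11A1.quadraticTwist (d : ℚ) = W₁) :
    haveI : Fact (Nat.Prime 2) := ⟨Nat.prime_two⟩
    W₁.analyticRank = 0 ∧ ¬ W₁.HasCM ∧ GoodSS W₁ 2 ∧ BSDp W₁ 2 := by
  haveI := X1Eleven.instIsEllipticCurve11A1; haveI := Literature.NumberTheory.EllipticCurves.BurungaleSkinner2023.isGloballyMinimal_curve11A1
  obtain ⟨hr, hcm, hB⟩ := KrizLiAnchor11a1.printFamily11A1_krizLi_rankZeroMembers hKL h33 htab hS31 hmod K hK hdK hd hsign W₁ hW₁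
  obtain ⟨C, hC⟩ := hW₁
  exact ⟨hr, hcm, goodSS_two_of_smul_quadraticTwist_of_emod_four_eq_one _ W₁ hd.1 hC goodSS_two_11A1, hB⟩

/-! ### `37b1` (rank-zero anchor): the rank-zero members `37b1^{(d)}` are good supersingular at `2` -/

/-- **`37b1` is good SUPERSINGULAR at `2`** (`a₁ = 0` on the minimal model; Kriz–Li's (★) needs `a₂` even). [cite: SilvermanAEC2009, V.4] [cite: KrizLi2019, §6 Example 6.2/6.5] -/
theorem goodSS_two_37B1 :
    haveI := KrizLiAnchor37b1.isGloballyMinimal_37B1; haveI : Fact (Nat.Prime 2) := ⟨Nat.prime_two⟩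
    GoodSS (⟨0, 1, 1, -23, -50⟩ : WeierstrassCurve ℚ) 2 := by
  haveI := KrizLiAnchor37b1.isElliptic_37B1; haveI := KrizLiAnchor37b1.isGloballyMinimal_37B1
  exact goodSS_two_of_even_a₁ _ KrizLiAnchor37b1.hasGoodReductionAtPrime_two_37B1 (by rw [KrizLiAnchor37b1.intModel_37B1]; exact ⟨0, rfl⟩)

/-- ★ **PRINT-DECIDED INSTANCES OF THE SUPERSINGULAR RANK-ZERO WALL ROW** (item 19097 / the route's `WallSupersingularRankZeroAtTwo`): at every global minimal
`W₁ ≅ 37b1^{(d)}` (`d ∈ 𝒩(37b1, K)`, `d_K = -7`, `χ_d(−N) = 1`): `r_an(W₁) = 0 ∧ ¬CM(W₁) ∧ GoodSS W₁ 2 ∧ BSD(W₁, 2)` — the wall row's hypotheses AND its conclusion,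
from PRINT + MODULARITY alone (no wall item used).  BSD is not proved by any of this; the wall row is NOT proved (these are instances).
[cite: KrizLi2019, Thm. 5.1 (2), Thm. 4.3, §6 Table 2 / Example 6.4–6.5] [cite: CreutzMiller2012, Thm. 1.1] -/
theorem wallSSInstances_37B1 (hKL : KrizLi2019.thm112_bsdTwo_twist) (h33 : KrizLi2019.thm33_rank_twist)
    (htab : KrizLi2019.table2_row37b1) (hS31 : bsdTriple_of_analyticRank_le_one_of_conductor_lt) (hmod : exists_isNewformOf)
    (K : Type) [Field K] [NumberField K] (hK : IsImaginaryQuadratic K) (hdK : NumberField.discr K = -7)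
    {d : ℤ} (hd : haveI := KrizLiAnchor37b1.isGloballyMinimal_37B1; KrizLi2019.InN (⟨0, 1, 1, -23, -50⟩ : WeierstrassCurve ℚ) K d)
    (hsign : haveI := KrizLiAnchor37b1.isElliptic_37B1; Int.sign d * jacobiSym ((⟨0, 1, 1, -23, -50⟩ : WeierstrassCurve ℚ).conductorNorm ℤ) d.natAbs = 1)
    (W₁ : WeierstrassCurve ℚ) [W₁.IsElliptic] [W₁.IsGloballyMinimal]
    (hW₁ : ∃ C : VariableChange ℚ, C • (⟨0, 1, 1, -23, -50⟩ : WeierstrassCurve ℚ).quadraticTwist (d : ℚ) = W₁) :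
    haveI : Fact (Nat.Prime 2) := ⟨Nat.prime_two⟩
    W₁.analyticRank = 0 ∧ ¬ W₁.HasCM ∧ GoodSS W₁ 2 ∧ BSDp W₁ 2 := by
  haveI := KrizLiAnchor37b1.isElliptic_37B1; haveI := KrizLiAnchor37b1.isGloballyMinimal_37B1
  obtain ⟨hr, hcm, hB⟩ := KrizLiAnchor37b1.printFamily37B1_krizLi_rankZeroMembers_of_modularity hKL h33 htab hS31 hmod K hK hdK hd hsign W₁ hW₁
  obtain ⟨C, hC⟩ := hW₁
  exact ⟨hr, hcm, goodSS_two_of_smul_quadraticTwist_of_emod_four_eq_one _ W₁ hd.1 hC goodSS_two_37B1, hB⟩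

/-! ### `67a1` (rank-zero anchor): the rank-zero members `67a1^{(d)}` are good supersingular at `2` -/

/-- **`67a1` is good SUPERSINGULAR at `2`** (`a₁ = 0` on the minimal model; Kriz–Li's (★) needs `a₂` even). [cite: SilvermanAEC2009, V.4] [cite: KrizLi2019, §6 Example 6.2/6.5] -/
theorem goodSS_two_67A1 :
    haveI := KrizLiAnchor67a1.isGloballyMinimal_67A1; haveI : Fact (Nat.Prime 2) := ⟨Nat.prime_two⟩
    GoodSS (⟨0, 1, 1, -12, -21⟩ : WeierstrassCurve ℚ) 2 := by
  haveI := KrizLiAnchor67a1.isElliptic_67A1; haveI := KrizLiAnchor67a1.isGloballyMinimal_67A1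
  exact goodSS_two_of_even_a₁ _ KrizLiAnchor67a1.hasGoodReductionAtPrime_two_67A1 (by rw [KrizLiAnchor67a1.intModel_67A1]; exact ⟨0, rfl⟩)

/-- ★ **PRINT-DECIDED INSTANCES OF THE SUPERSINGULAR RANK-ZERO WALL ROW** (item 19097 / the route's `WallSupersingularRankZeroAtTwo`): at every global minimal
`W₁ ≅ 67a1^{(d)}` (`d ∈ 𝒩(67a1, K)`, `d_K = -7`, `χ_d(−N) = 1`): `r_an(W₁) = 0 ∧ ¬CM(W₁) ∧ GoodSS W₁ 2 ∧ BSD(W₁, 2)` — the wall row's hypotheses AND its conclusion,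
from PRINT + MODULARITY alone (no wall item used).  BSD is not proved by any of this; the wall row is NOT proved (these are instances).
[cite: KrizLi2019, Thm. 5.1 (2), Thm. 4.3, §6 Table 2 / Example 6.4–6.5] [cite: CreutzMiller2012, Thm. 1.1] -/
theorem wallSSInstances_67A1 (hKL : KrizLi2019.thm112_bsdTwo_twist) (h33 : KrizLi2019.thm33_rank_twist)
    (htab : KrizLi2019.table2_row67a1) (hS31 : bsdTriple_of_analyticRank_le_one_of_conductor_lt) (hmod : exists_isNewformOf)
    (K : Type) [Field K] [NumberField K] (hK : IsImaginaryQuadratic K) (hdK : NumberField.discr K = -7)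
    {d : ℤ} (hd : haveI := KrizLiAnchor67a1.isGloballyMinimal_67A1; KrizLi2019.InN (⟨0, 1, 1, -12, -21⟩ : WeierstrassCurve ℚ) K d)
    (hsign : haveI := KrizLiAnchor67a1.isElliptic_67A1; Int.sign d * jacobiSym ((⟨0, 1, 1, -12, -21⟩ : WeierstrassCurve ℚ).conductorNorm ℤ) d.natAbs = 1)
    (W₁ : WeierstrassCurve ℚ) [W₁.IsElliptic] [W₁.IsGloballyMinimal]
    (hW₁ : ∃ C : VariableChange ℚ, C • (⟨0, 1, 1, -12, -21⟩ : WeierstrassCurve ℚ).quadraticTwist (d : ℚ) = W₁) :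
    haveI : Fact (Nat.Prime 2) := ⟨Nat.prime_two⟩
    W₁.analyticRank = 0 ∧ ¬ W₁.HasCM ∧ GoodSS W₁ 2 ∧ BSDp W₁ 2 := by
  haveI := KrizLiAnchor67a1.isElliptic_67A1; haveI := KrizLiAnchor67a1.isGloballyMinimal_67A1
  obtain ⟨hr, hcm, hB⟩ := KrizLiAnchor67a1.printFamily67A1_krizLi_rankZeroMembers_of_modularity hKL h33 htab hS31 hmod K hK hdK hd hsign W₁ hW₁
  obtain ⟨C, hC⟩ := hW₁
  exact ⟨hr, hcm, goodSS_two_of_smul_quadraticTwist_of_emod_four_eq_one _ W₁ hd.1 hC goodSS_two_67A1, hB⟩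

/-! ### `37a1` (rank-one anchor): the rank-zero companions `37a1^{(−7d)}` are good supersingular at `2` -/

/-- **`37a1` is good SUPERSINGULAR at `2`** (`a₁ = 0` on the minimal model). [cite: SilvermanAEC2009, V.4] [cite: KrizLi2019, §6 Example 6.2] -/
theorem goodSS_two_37A1 :
    haveI := KrizLiAnchor37a1.isGloballyMinimal_37A1; haveI : Fact (Nat.Prime 2) := ⟨Nat.prime_two⟩
    GoodSS Curve37a.E 2 := by
  haveI := Curve37a.E_isElliptic; haveI := KrizLiAnchor37a1.isGloballyMinimal_37A1
  exact goodSS_two_of_even_a₁ _ KrizLiAnchor37a1.hasGoodReductionAtPrime_two_37A1 (by rw [KrizLiAnchor37a1.intModel_37A1]; exact ⟨0, rfl⟩)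

/-- ★ **PRINT-DECIDED INSTANCES OF THE SUPERSINGULAR RANK-ZERO WALL ROW** (item 19097 / the route's `WallSupersingularRankZeroAtTwo`): at every global minimal
`W₂ ≅ 37a1^{(−7d)}` (`d ∈ 𝒩(37a1, K)`, `d_K = −7`, `χ_d(−N) = 1`): `r_an(W₂) = 0 ∧ ¬CM(W₂) ∧ GoodSS W₂ 2 ∧ BSD(W₂, 2)`, from PRINT + MODULARITY alone (no wall
item used).  BSD is not proved by any of this; the wall row is NOT proved (these are instances).
[cite: KrizLi2019, Thm. 5.1 (2), Thm. 4.3, §6 Table 1 / Example 6.1–6.2] [cite: CreutzMiller2012, Thm. 1.1] -/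
theorem wallSSInstances_37A1 (hKL : KrizLi2019.thm112_bsdTwo_twist) (h33 : KrizLi2019.thm33_rank_twist)
    (htab : KrizLi2019.table1_row37a1) (hS31 : bsdTriple_of_analyticRank_le_one_of_conductor_lt) (hmod : exists_isNewformOf)
    (K : Type) [Field K] [NumberField K] (hK : IsImaginaryQuadratic K) (hdK : NumberField.discr K = -7)
    {d : ℤ} (hd : haveI := KrizLiAnchor37a1.isGloballyMinimal_37A1; KrizLi2019.InN Curve37a.E K d)
    (hsign : haveI := Curve37a.E_isElliptic; Int.sign d * jacobiSym (Curve37a.E.conductorNorm ℤ) d.natAbs = 1)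
    (W₂ : WeierstrassCurve ℚ) [W₂.IsElliptic] [W₂.IsGloballyMinimal]
    (hW₂ : ∃ C : VariableChange ℚ, C • Curve37a.E.quadraticTwist ((-7 * d : ℤ) : ℚ) = W₂) :
    haveI : Fact (Nat.Prime 2) := ⟨Nat.prime_two⟩
    W₂.analyticRank = 0 ∧ ¬ W₂.HasCM ∧ GoodSS W₂ 2 ∧ BSDp W₂ 2 := by
  haveI := Curve37a.E_isElliptic; haveI := KrizLiAnchor37a1.isGloballyMinimal_37A1
  obtain ⟨hr, hcm, hB⟩ := KrizLiAnchor37a1.printFamily37A1_krizLi_rankZeroCompanions hKL h33 htab hS31 hmod K hK hdK hd hsign W₂ hW₂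
  obtain ⟨C, hC⟩ := hW₂
  have h4 : (-7 * d) % 4 = 1 := by rw [Int.mul_emod, hd.1]; decide
  exact ⟨hr, hcm, goodSS_two_of_smul_quadraticTwist_of_emod_four_eq_one _ W₂ h4 hC goodSS_two_37A1, hB⟩

/-! ### `43a1` (rank-one anchor): the rank-zero companions `43a1^{(−7d)}` are good supersingular at `2` -/

/-- **`43a1` is good SUPERSINGULAR at `2`** (`a₁ = 0` on the minimal model). [cite: SilvermanAEC2009, V.4] [cite: KrizLi2019, §6 Example 6.2] -/
theorem goodSS_two_43A1 :
    haveI := KrizLiAnchor43a1.isGloballyMinimal_43A1; haveI : Fact (Nat.Prime 2) := ⟨Nat.prime_two⟩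
    GoodSS (⟨0, 1, 1, 0, 0⟩ : WeierstrassCurve ℚ) 2 := by
  haveI := KrizLiAnchor43a1.isElliptic_43A1; haveI := KrizLiAnchor43a1.isGloballyMinimal_43A1
  exact goodSS_two_of_even_a₁ _ KrizLiAnchor43a1.hasGoodReductionAtPrime_two_43A1 (by rw [KrizLiAnchor43a1.intModel_43A1]; exact ⟨0, rfl⟩)

/-- ★ **PRINT-DECIDED INSTANCES OF THE SUPERSINGULAR RANK-ZERO WALL ROW** (item 19097 / the route's `WallSupersingularRankZeroAtTwo`): at every global minimal
`W₂ ≅ 43a1^{(−7d)}` (`d ∈ 𝒩(43a1, K)`, `d_K = −7`, `χ_d(−N) = 1`): `r_an(W₂) = 0 ∧ ¬CM(W₂) ∧ GoodSS W₂ 2 ∧ BSD(W₂, 2)`, from PRINT + GZK alone (no wall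
item used).  BSD is not proved by any of this; the wall row is NOT proved (these are instances).
[cite: KrizLi2019, Thm. 5.1 (2), Thm. 4.3, §6 Table 1 / Example 6.1–6.2] [cite: CreutzMiller2012, Thm. 1.1] -/
theorem wallSSInstances_43A1 (hKL : KrizLi2019.thm112_bsdTwo_twist) (h33 : KrizLi2019.thm33_rank_twist)
    (htab : KrizLi2019.table1_row43a1) (hS31 : bsdTriple_of_analyticRank_le_one_of_conductor_lt) (hGZK : rank_eq_analyticRank_of_analyticRank_le_one)
    (K : Type) [Field K] [NumberField K] (hK : IsImaginaryQuadratic K) (hdK : NumberField.discr K = -7)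
    {d : ℤ} (hd : haveI := KrizLiAnchor43a1.isGloballyMinimal_43A1; KrizLi2019.InN (⟨0, 1, 1, 0, 0⟩ : WeierstrassCurve ℚ) K d)
    (hsign : haveI := KrizLiAnchor43a1.isElliptic_43A1; Int.sign d * jacobiSym ((⟨0, 1, 1, 0, 0⟩ : WeierstrassCurve ℚ).conductorNorm ℤ) d.natAbs = 1)
    (W₂ : WeierstrassCurve ℚ) [W₂.IsElliptic] [W₂.IsGloballyMinimal]
    (hW₂ : ∃ C : VariableChange ℚ, C • (⟨0, 1, 1, 0, 0⟩ : WeierstrassCurve ℚ).quadraticTwist ((-7 * d : ℤ) : ℚ) = W₂) :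
    haveI : Fact (Nat.Prime 2) := ⟨Nat.prime_two⟩
    W₂.analyticRank = 0 ∧ ¬ W₂.HasCM ∧ GoodSS W₂ 2 ∧ BSDp W₂ 2 := by
  haveI := KrizLiAnchor43a1.isElliptic_43A1; haveI := KrizLiAnchor43a1.isGloballyMinimal_43A1
  obtain ⟨hr, hcm, hB⟩ := KrizLiAnchor43a1.printFamily43A1_krizLi_rankZeroCompanions hKL h33 htab hS31 hGZK K hK hdK hd hsign W₂ hW₂
  obtain ⟨C, hC⟩ := hW₂
  have h4 : (-7 * d) % 4 = 1 := by rw [Int.mul_emod, hd.1]; decide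
  exact ⟨hr, hcm, goodSS_two_of_smul_quadraticTwist_of_emod_four_eq_one _ W₂ h4 hC goodSS_two_43A1, hB⟩

end Summit.BirchSwinnertonDyer.BirchSwinnertonDyer.Theorems.GenusExact.TwinSwap.KrizLiAnchorsPrintWallSS

end
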